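import Summits.QuantumFields.YangMills.Theorems.BalabanUVNodesN11NoExpansionAllLargeCoP
import Literature.MathematicalPhysics.QuantumFieldTheory.Balaban1983to89.B16RLeafRecord13LiveClauseW

/-!
# DAG node N11 — THE s2∕s3 JUNCTION ON THE NO-EXPANSION DIAGONAL at the v1.5 `CoP` record: dag-n11-d's 𝐓-side clause at the all-large-field sequence
# (`hasSect2FormAtZ_clause_succ_CoP_of_allLarge_pin`, [III] (3.24)–(3.25) under the generation-`k` pin) + this seat's clause-level 𝐑-transfer on the live line
# (`…B16RLeafRecord13LiveClauseW`, [IV] (0.3)) ⇒ THE §2 CLAUSE OF `ρ_{k+1}`'s SLOT at that sequence; at `k = 0` the hypothesis `SLaw₁₃CoP θ p 0` is def-T's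
# `sLaw₁₃CoP_zero`, so THE LEVEL-1 POST-𝐑 SLOT OF THE LARGE-FIELD DIAGONAL HAS §2 FORM modulo the generation-0 pin alone

Cell `pub-ymgap`, YM-PLAN Track A (HUMAN RULING D-0062), seat `pub-ymgap-dag-n11-e` (g9; R134 fan-out row N11∕s3 «`ThmP245Printed` via `rOperation` from N13's
`ROpLeaf` (pairs with n13-c)»), route `BalabanUVNodes` rev 21, item K1⁵ `StabilityBAtRecordR13SepCoP` = stmt-QuantumFields-20294 (helper, count-neutral).
[III] = [Balaban1988Convergent], [IV] = [Balaban1989LargeFieldI].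

WHY THIS FILE.  Theorem 1 of [III] (p. 262) is the induction «§2 form of `ρ_k` ⇒ (Theorem p. 245, Sects. 1–3) 𝐓-image form of `𝐓ρ_k` ⇒ (𝐑, p. 244 ∕ [IV]) §2 form
of `ρ_{k+1}`».  At the v1.5 `CoP` record the two arrows are typed level-wise as `SLaw₁₃CoP θ p k → TLaw₁₃CoP θ p k` ((S1ᵀ), seats dag-n11-c∕-d) and
`TLaw₁₃CoP θ p k → SLaw₁₃CoP θ p (k+1)` (the 𝐑-leaf, this seat's `…B16RLeafRecord13LiveCoP`, a THEOREM on the live line).  dag-n11-d g7 (p528220) proved the FIRST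
arrow's CLAUSE at the one new sequence per level that carries no small-field expansion — the all-large-field sequence `s′` of length `k+1` — for every term-value
witness, under the generation-`k` pin of the tuple's residual 𝐓-weight `ζ0_k(T)(V_k,V_{k+1}) := w_k(s′)(V_k, V̄_k)` (+ 12b locality, `quad_j(∅) = 0`, unity of def-T's
`ζ`, displayed measurability ∕ bound).  This file composes it with the SECOND arrow's clause (this seat's `slotClause_succ_of_slotTClause_of_liveSel_of_rstep`: on
the live line a dead `s′` is absent from `ρ_{k+1}`, a live `s′` is a fixed point of the selector where `slot = slotT` a.e. on the support): §1 at any `θ` carrying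
node00-def-T's live-selector clause, from row `rstep` or from K0b's `HasResidualsOfRecord` alone — `SLaw₁₃CoP θ p k` + pin ⇒ the §2 DICHOTOMY of
`slot_{k+1}(s′)` for EVERY term-value witness `t′` with the constant of p528220; §2 THE LEVEL-ONE COROLLARY (`k = 0`, `sLaw₁₃CoP_zero`): the post-𝐑 slot of `ρ₁`
at the all-large-field sequence of length 1 has the §2 dichotomy modulo the generation-0 pin; §3 the LAW conjunct for the zero term values (11c's
`Sect2.lawsRT_towerOfTerms_zero` at the setting of record: RG equations by `settingOfRecord₁₃_satisfiesRG`, signs displayed) — so §2's clause is a complete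
instance of the per-sequence body of def-T's `HasSect2FormAtZ` at level 1.

WHERE THE PIN LIVES (honest).  At every `θ : Stage13Params` of the v1.5 type the residual slot `θ.Zt K` is RUN-BLIND (def-T LOCATED-8 = FINDING №8, ref-D∕ref-H
REAL): the pin `hZ` reads the run (`w_0(s′)` carries `ε₀(g₀)`), so it is satisfiable run by run but by no single `θ` for every run in a coupling window, and it
FAILS at K0b's uniform residual `ZtOfRecord` (dag-n11-d ANSWER-169: (★) not provable).  Under director-ym LINE №169∕№174 (v1.6 `Stage13RParams`, run-indexed
`Zr`, token map `θ.Zt p.K ↦ θ.Zr p`) the pin becomes a property of K0a∕K0b's `Zr` of record BY CONSTRUCTION (dag-n11-d INTENT-5 `exists_residual_pinned_on_univ`),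
and this file ports by the same token map (its 𝐑-side import is edition-free).

HONEST FRAMING.  Count-neutral kernel bookkeeping; a 30-line composition of two tree theorems; the pin, the live-selector clause, `rstep` ∕ `HasResidualsOfRecord`,
`1 ≤ M`, unity and the measurability ∕ bound data are DISPLAYED hypotheses; every OTHER new sequence of level `k+1` is [III] §3 ∕ Thm 2 proper (not here); N11
NOT discharged; K1⁵ NOT closed; nothing of Bałaban asserted; counts unmoved (typed 28∕28 · discharged 5∕28).  One finite `𝕋⁴_{L^K}` programme at fixed
`ε = L^{−K}`; NOT continuum ∕ OS ∕ mass-gap ∕ Clay.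
-/

noncomputable section

open MeasureTheory
open scoped BigOperators Matrix.Norms.L2Operator

namespace Summit.QuantumFields.YangMills.Theorems.BalabanUVNodesN11DiagonalLevelOneCoP

open Literature.MathematicalPhysics.QuantumFieldTheory.Balaban1983to89 T4Continuum Node00 Node00.Tk DagBinding
open Literature.MathematicalPhysics.QuantumFieldTheory.Balaban1983to89.B16RLeafRecord13LiveClauseW
open Literature.MathematicalPhysics.QuantumFieldTheory.Balaban1983to89.B16RLeafRecord13LiveRstep (rstep₁₃_of_liveSel_of_hasResiduals)
open Literature.MathematicalPhysics.QuantumFieldTheory.Balaban1983to89.B16RLeafRecord13Live (gOfRecord₁₃_succ_nonneg)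
open BalabanUVNodesN11NoExpansionAllLargeCoP (hasSect2FormAtZ_clause_succ_CoP_of_allLarge_pin)

variable {F : T4Family} {N : ℕ} [NeZero N]

/-! ## §1. Level `k+1`: the 𝐓-side clause of p528220 composed with the 𝐑-side clause transfer on the live line -/

section Succ

variable (θ : Stage13Params F N) (p : B12.RunParams)

/-- **★★ THE §2 CLAUSE OF `ρ_{k+1}`'s SLOT AT THE ALL-LARGE-FIELD SEQUENCE, live selector, from row `rstep`**: `SLaw₁₃CoP θ p k` + the generation-`k` pin
(+ 12b locality, `quad_j(∅) = 0`, unity of def-T's `ζ`, displayed measurability ∕ bound of the old branch and of `w_k(s′)`) give, for EVERY term-value witness `t′`,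
a constant `E_{k+1}(s′)` with «`slot_{k+1}(s′) = 0 ∨ slot_{k+1}(s′) = 𝐓_{k+1}(s′)e^{A_{k+1}(s′)}` `dV′`-a.e. on `supp χ_{k+1}(s′)`» at the `CoP` weights and background of
record — dag-n11-d's 𝐓-side clause (p528220) followed by this seat's 𝐑-side clause transfer (`slotClause_succ_of_slotTClause_of_liveSel_of_rstep`).
[cite: Balaban1988Convergent, Theorem p.245, Thm 1 p.262, (3.24)–(3.25) p.270; Balaban1989LargeFieldI, (0.3) p.176, p.177 (i)–(ii)] -/
theorem slotClause_succ_allLarge_CoP_of_pin_of_liveSel_of_rstep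
    (hrstep : ∀ (p : B12.RunParams) (k : ℕ) [DecidableEq (PBond (F.P p.K) (k + 1))], k < p.K →
      (towerRepOfRecord F N θ.ν θ.τ9 (slotsTOfRecord F N θ.ν θ.τ9 (EOfRecord₁₃ F N θ) (wOfRecord₉ F N θ.toStage9Params) θ.ppSel)
        θ.ppSel p (gOfRecord₁₃ F N θ p) (k + 1)).toRepData.ProvisosInt)
    (hsel : θ.ppSel = ppSelLiveOfRecord F N θ.ν θ.τ9 (EOfRecord₁₃ F N θ) (wOfRecord₉ F N θ.toStage9Params))
    {k : ℕ} (hk : k < p.K) (hM : 1 ≤ θ.τ9.M) (hζu : IsZetaUnity F N θ.ν θ.τ9.M θ.ζ)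
    (hloc : (θ.Zt p.K).LocalLaws) (hq : ∀ (j : ℕ) (ω : MultiCfg (F.P p.K) (SU N) (FluctV N)), (θ.Zt p.K).quad j ∅ ω = 0)
    (hS : SLaw₁₃CoP F N θ p k)
    (s : SeqOfRecord F θ.ν θ.τ9.M (gOfRecord₁₃ F N θ p) p.K (k + 1)) (hall : ∀ j, 1 ≤ j → j ≤ k + 1 → s.Ω j = ∅)
    (hZ : ∀ (V' : GaugeField (F.P p.K) (k + 1) (SU N)) (U₀ : GaugeField (F.P p.K) k (SU N)),
      (θ.Zt p.K).ζ0 k Set.univ (pairCfgAt (V := FluctV N) k V' U₀) =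
        wOfRecord₉ F N θ.toStage9Params p (gOfRecord₁₃ F N θ p) k s U₀ ((avOfRecord F N p.K k).avg U₀))
    (hmw : Measurable fun z : GaugeField (F.P p.K) (k + 1) (SU N) × GaugeField (F.P p.K) k (SU N) =>
      wOfRecord₉ F N θ.toStage9Params p (gOfRecord₁₃ F N θ p) k s z.2 z.1)
    {C : ℝ}
    (hmB : ∀ (t : Sect2.TermValues (F.P p.K) (MatA N) (FluctV N) θ.τ9.M) (Ek : ℝ),
      Measurable fun U₀ : GaugeField (F.P p.K) k (SU N) =>
        tkBranchOfRecord F N (FluctV N) θ.ν θ.τ9.M _ p.K (WtOfRecord₁₃P F N θ p) s.init (fun _ => ∅) k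
          (fun ω => sect2Operand F N (FluctV N) p.K (settingOfRecord₁₃ F N θ p) (θ.Rz p.K) s.init t Ek (UbgOfRecord₁₃CoP F N θ p k s.init)
            ((fun _ => ∅ : ℕ → Set (Site (F.P p.K) 0)), fun j => (ω j).2) (fun j => (ω j).1))
          (baseCfg (V := FluctV N) k U₀))
    (hCB : ∀ (t : Sect2.TermValues (F.P p.K) (MatA N) (FluctV N) θ.τ9.M) (Ek : ℝ) (U₀ : GaugeField (F.P p.K) k (SU N)),
      |tkBranchOfRecord F N (FluctV N) θ.ν θ.τ9.M _ p.K (WtOfRecord₁₃P F N θ p) s.init (fun _ => ∅) k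
          (fun ω => sect2Operand F N (FluctV N) p.K (settingOfRecord₁₃ F N θ p) (θ.Rz p.K) s.init t Ek (UbgOfRecord₁₃CoP F N θ p k s.init)
            ((fun _ => ∅ : ℕ → Set (Site (F.P p.K) 0)), fun j => (ω j).2) (fun j => (ω j).1))
          (baseCfg (V := FluctV N) k U₀)| ≤ C)
    (t' : Sect2.TermValues (F.P p.K) (MatA N) (FluctV N) θ.τ9.M) :
    ∃ Ek' : ℝ,
      slotsOfRecord F N θ.ν θ.τ9 (EOfRecord₁₃ F N θ) (wOfRecord₉ F N θ.toStage9Params) θ.ppSel p (gOfRecord₁₃ F N θ p) (k + 1) s = 0 ∨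
        ∀ᵐ V' ∂fieldMeasure (F.P p.K) (k + 1) (SU N),
          chiSeqOfRecord F N θ.ν θ.τ9.M (gOfRecord₁₃ F N θ p) p.K (k + 1) s V' ≠ 0 →
            slotsOfRecord F N θ.ν θ.τ9 (EOfRecord₁₃ F N θ) (wOfRecord₉ F N θ.toStage9Params) θ.ppSel p (gOfRecord₁₃ F N θ p) (k + 1) s V' =
              sect2Slot F N (FluctV N) p.K (settingOfRecord₁₃ F N θ p) (θ.Rz p.K) (WtOfRecord₁₃P F N θ p) s t' Ek'
                (UbgOfRecord₁₃CoP F N θ p (k + 1) s) V' := by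
  obtain ⟨Ek', h⟩ := hasSect2FormAtZ_clause_succ_CoP_of_allLarge_pin θ p hk hM hζu hloc hq hS s hall hZ hmw hmB hCB t'
  exact ⟨Ek', slotClause_succ_of_slotTClause_of_liveSel_of_rstep F N θ p hrstep hsel k hk (WtOfRecord₁₃P F N θ p) s t' Ek'
    (UbgOfRecord₁₃CoP F N θ p (k + 1) s) fun _ => h⟩

/-- **★★ The same from K0b's `HasResidualsOfRecord` ALONE** in place of row `rstep` (the live line of record: `rstep` is a theorem there, `rstep₁₃_of_liveSel_of_hasResiduals`).
[cite: Balaban1988Convergent, Theorem p.245, Thm 1 p.262, (3.16) p.268, (3.24)–(3.25) p.270; Balaban1989LargeFieldI, (0.3)–(0.4) p.176, p.177 (i)–(ii)] -/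
theorem slotClause_succ_allLarge_CoP_of_pin_of_liveSel_of_hasResiduals (hres : θ.HasResidualsOfRecord F N)
    (hsel : θ.ppSel = ppSelLiveOfRecord F N θ.ν θ.τ9 (EOfRecord₁₃ F N θ) (wOfRecord₉ F N θ.toStage9Params))
    {k : ℕ} (hk : k < p.K) (hM : 1 ≤ θ.τ9.M) (hζu : IsZetaUnity F N θ.ν θ.τ9.M θ.ζ)
    (hloc : (θ.Zt p.K).LocalLaws) (hq : ∀ (j : ℕ) (ω : MultiCfg (F.P p.K) (SU N) (FluctV N)), (θ.Zt p.K).quad j ∅ ω = 0)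
    (hS : SLaw₁₃CoP F N θ p k)
    (s : SeqOfRecord F θ.ν θ.τ9.M (gOfRecord₁₃ F N θ p) p.K (k + 1)) (hall : ∀ j, 1 ≤ j → j ≤ k + 1 → s.Ω j = ∅)
    (hZ : ∀ (V' : GaugeField (F.P p.K) (k + 1) (SU N)) (U₀ : GaugeField (F.P p.K) k (SU N)),
      (θ.Zt p.K).ζ0 k Set.univ (pairCfgAt (V := FluctV N) k V' U₀) =
        wOfRecord₉ F N θ.toStage9Params p (gOfRecord₁₃ F N θ p) k s U₀ ((avOfRecord F N p.K k).avg U₀))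
    (hmw : Measurable fun z : GaugeField (F.P p.K) (k + 1) (SU N) × GaugeField (F.P p.K) k (SU N) =>
      wOfRecord₉ F N θ.toStage9Params p (gOfRecord₁₃ F N θ p) k s z.2 z.1)
    {C : ℝ}
    (hmB : ∀ (t : Sect2.TermValues (F.P p.K) (MatA N) (FluctV N) θ.τ9.M) (Ek : ℝ),
      Measurable fun U₀ : GaugeField (F.P p.K) k (SU N) =>
        tkBranchOfRecord F N (FluctV N) θ.ν θ.τ9.M _ p.K (WtOfRecord₁₃P F N θ p) s.init (fun _ => ∅) k
          (fun ω => sect2Operand F N (FluctV N) p.K (settingOfRecord₁₃ F N θ p) (θ.Rz p.K) s.init t Ek (UbgOfRecord₁₃CoP F N θ p k s.init)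
            ((fun _ => ∅ : ℕ → Set (Site (F.P p.K) 0)), fun j => (ω j).2) (fun j => (ω j).1))
          (baseCfg (V := FluctV N) k U₀))
    (hCB : ∀ (t : Sect2.TermValues (F.P p.K) (MatA N) (FluctV N) θ.τ9.M) (Ek : ℝ) (U₀ : GaugeField (F.P p.K) k (SU N)),
      |tkBranchOfRecord F N (FluctV N) θ.ν θ.τ9.M _ p.K (WtOfRecord₁₃P F N θ p) s.init (fun _ => ∅) k
          (fun ω => sect2Operand F N (FluctV N) p.K (settingOfRecord₁₃ F N θ p) (θ.Rz p.K) s.init t Ek (UbgOfRecord₁₃CoP F N θ p k s.init)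
            ((fun _ => ∅ : ℕ → Set (Site (F.P p.K) 0)), fun j => (ω j).2) (fun j => (ω j).1))
          (baseCfg (V := FluctV N) k U₀)| ≤ C)
    (t' : Sect2.TermValues (F.P p.K) (MatA N) (FluctV N) θ.τ9.M) :
    ∃ Ek' : ℝ,
      slotsOfRecord F N θ.ν θ.τ9 (EOfRecord₁₃ F N θ) (wOfRecord₉ F N θ.toStage9Params) θ.ppSel p (gOfRecord₁₃ F N θ p) (k + 1) s = 0 ∨
        ∀ᵐ V' ∂fieldMeasure (F.P p.K) (k + 1) (SU N),
          chiSeqOfRecord F N θ.ν θ.τ9.M (gOfRecord₁₃ F N θ p) p.K (k + 1) s V' ≠ 0 →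
            slotsOfRecord F N θ.ν θ.τ9 (EOfRecord₁₃ F N θ) (wOfRecord₉ F N θ.toStage9Params) θ.ppSel p (gOfRecord₁₃ F N θ p) (k + 1) s V' =
              sect2Slot F N (FluctV N) p.K (settingOfRecord₁₃ F N θ p) (θ.Rz p.K) (WtOfRecord₁₃P F N θ p) s t' Ek'
                (UbgOfRecord₁₃CoP F N θ p (k + 1) s) V' :=
  slotClause_succ_allLarge_CoP_of_pin_of_liveSel_of_rstep θ p (rstep₁₃_of_liveSel_of_hasResiduals hsel hres) hsel hk hM hζu hloc hq hS s hall hZ hmw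
    hmB hCB t'

end Succ

/-! ## §2. LEVEL ONE: `SLaw₁₃CoP θ p 0` is def-T's `sLaw₁₃CoP_zero` — the first post-𝐑 §2 clause beyond level 0, modulo the generation-0 pin -/

section LevelOne

variable (θ : Stage13Params F N) (p : B12.RunParams)

/-- **★★★ THE LEVEL-1 POST-𝐑 SLOT OF THE LARGE-FIELD DIAGONAL HAS THE §2 DICHOTOMY** (live selector, K0b's `HasResidualsOfRecord`, `0 < K`, `1 ≤ M`, unity of
def-T's `ζ`; the GENERATION-0 PIN `ζ0_0(T)(U, V₁) = w_0(s′)(U, Ū)` and the displayed measurability ∕ bound are the only other hypotheses): for the all-large-field new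
sequence `s′` of length 1 and EVERY term-value witness `t′` there is a constant `E₁(s′)` with «`slot₁(s′) = 0 ∨ slot₁(s′) = 𝐓₁(s′)e^{A₁(s′)}` a.e. on `supp χ₁(s′)`» —
the start `SLaw₁₃CoP θ p 0` (def-T's `sLaw₁₃CoP_zero`: `ρ₀ = e^{−g₀⁻²A − E}`, no terms) fed to §1.  THE FIRST INSTANCE OF THEOREM 1's INDUCTION STEP «ρ₀ ⇒ 𝐓ρ₀ ⇒ ρ₁»
CLOSED IN KERNEL at a sequence of the record, both arrows by name (dag-n11-d p528220, this seat's 𝐑-side), modulo the pin that director-ym LINE №169's v1.6 slot makes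
constructible. [cite: Balaban1988Convergent, Thm 1 p.262, Theorem p.245, (3.24)–(3.25) p.270, (1.11) p.248; Balaban1989LargeFieldI, (0.3)–(0.4) p.176] -/
theorem slotClause_one_allLarge_CoP_of_pin_of_liveSel_of_hasResiduals (hres : θ.HasResidualsOfRecord F N)
    (hsel : θ.ppSel = ppSelLiveOfRecord F N θ.ν θ.τ9 (EOfRecord₁₃ F N θ) (wOfRecord₉ F N θ.toStage9Params))
    (hK : 0 < p.K) (hM : 1 ≤ θ.τ9.M) (hζu : IsZetaUnity F N θ.ν θ.τ9.M θ.ζ)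
    (hloc : (θ.Zt p.K).LocalLaws) (hq : ∀ (j : ℕ) (ω : MultiCfg (F.P p.K) (SU N) (FluctV N)), (θ.Zt p.K).quad j ∅ ω = 0)
    (s : SeqOfRecord F θ.ν θ.τ9.M (gOfRecord₁₃ F N θ p) p.K 1) (hall : s.Ω 1 = ∅)
    (hZ : ∀ (V' : GaugeField (F.P p.K) 1 (SU N)) (U₀ : GaugeField (F.P p.K) 0 (SU N)),
      (θ.Zt p.K).ζ0 0 Set.univ (pairCfgAt (V := FluctV N) 0 V' U₀) =
        wOfRecord₉ F N θ.toStage9Params p (gOfRecord₁₃ F N θ p) 0 s U₀ ((avOfRecord F N p.K 0).avg U₀))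
    (hmw : Measurable fun z : GaugeField (F.P p.K) 1 (SU N) × GaugeField (F.P p.K) 0 (SU N) =>
      wOfRecord₉ F N θ.toStage9Params p (gOfRecord₁₃ F N θ p) 0 s z.2 z.1)
    {C : ℝ}
    (hmB : ∀ (t : Sect2.TermValues (F.P p.K) (MatA N) (FluctV N) θ.τ9.M) (Ek : ℝ),
      Measurable fun U₀ : GaugeField (F.P p.K) 0 (SU N) =>
        tkBranchOfRecord F N (FluctV N) θ.ν θ.τ9.M _ p.K (WtOfRecord₁₃P F N θ p) s.init (fun _ => ∅) 0
          (fun ω => sect2Operand F N (FluctV N) p.K (settingOfRecord₁₃ F N θ p) (θ.Rz p.K) s.init t Ek (UbgOfRecord₁₃CoP F N θ p 0 s.init)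
            ((fun _ => ∅ : ℕ → Set (Site (F.P p.K) 0)), fun j => (ω j).2) (fun j => (ω j).1))
          (baseCfg (V := FluctV N) 0 U₀))
    (hCB : ∀ (t : Sect2.TermValues (F.P p.K) (MatA N) (FluctV N) θ.τ9.M) (Ek : ℝ) (U₀ : GaugeField (F.P p.K) 0 (SU N)),
      |tkBranchOfRecord F N (FluctV N) θ.ν θ.τ9.M _ p.K (WtOfRecord₁₃P F N θ p) s.init (fun _ => ∅) 0
          (fun ω => sect2Operand F N (FluctV N) p.K (settingOfRecord₁₃ F N θ p) (θ.Rz p.K) s.init t Ek (UbgOfRecord₁₃CoP F N θ p 0 s.init)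
            ((fun _ => ∅ : ℕ → Set (Site (F.P p.K) 0)), fun j => (ω j).2) (fun j => (ω j).1))
          (baseCfg (V := FluctV N) 0 U₀)| ≤ C)
    (t' : Sect2.TermValues (F.P p.K) (MatA N) (FluctV N) θ.τ9.M) :
    ∃ E₁ : ℝ,
      slotsOfRecord F N θ.ν θ.τ9 (EOfRecord₁₃ F N θ) (wOfRecord₉ F N θ.toStage9Params) θ.ppSel p (gOfRecord₁₃ F N θ p) 1 s = 0 ∨
        ∀ᵐ V' ∂fieldMeasure (F.P p.K) 1 (SU N),
          chiSeqOfRecord F N θ.ν θ.τ9.M (gOfRecord₁₃ F N θ p) p.K 1 s V' ≠ 0 →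
            slotsOfRecord F N θ.ν θ.τ9 (EOfRecord₁₃ F N θ) (wOfRecord₉ F N θ.toStage9Params) θ.ppSel p (gOfRecord₁₃ F N θ p) 1 s V' =
              sect2Slot F N (FluctV N) p.K (settingOfRecord₁₃ F N θ p) (θ.Rz p.K) (WtOfRecord₁₃P F N θ p) s t' E₁
                (UbgOfRecord₁₃CoP F N θ p 1 s) V' :=
  slotClause_succ_allLarge_CoP_of_pin_of_liveSel_of_hasResiduals θ p hres hsel hK hM hζu hloc hq (sLaw₁₃CoP_zero F N θ p) s
    (fun j h1 hj => by obtain rfl : j = 1 := le_antisymm hj h1; exact hall) hZ hmw hmB hCB t'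

/-- **THE LAW CONJUNCT AT LEVEL 1 FOR THE ZERO TERM VALUES** (so §2's clause at `t′ := 0` is a complete instance of the per-sequence body of def-T's
`HasSect2FormAtZ … 1`): on the tower of record at `s′` the zero term values satisfy the inductive assumptions at index `1` — the RG equations of the ₁₃ history
(`settingOfRecord₁₃_satisfiesRG`), the couplings `g₀ ≥ 0` (displayed) and `g₁ ≥ 0` (free, `gOfRecord₁₃_succ_nonneg`), the signs `E₀, B₀ ≥ 0` (displayed) — 11c's
`Sect2.lawsRT_towerOfTerms_zero`. [cite: Balaban1988Convergent, (2.27)–(2.31) pp.259–260, (2.42) p.261, Thm 1 p.262; Balaban1987RG1, (0.20) p.256] -/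
theorem lawsRT_one_zeroTerms (hg₀ : 0 ≤ p.g0) (hE₀ : 0 ≤ θ.s2.lf.E₀) (hB₀ : 0 ≤ θ.s2.lf.B₀)
    (s : SeqOfRecord F θ.ν θ.τ9.M (gOfRecord₁₃ F N θ p) p.K 1) :
    Sect2.LawsRT (sect2TowerOfRecord F N (FluctV N) p.K (settingOfRecord₁₃ F N θ p) (θ.Rz p.K) s (Sect2.TermValues.zero (V := FluctV N)))
      (settingOfRecord₁₃ F N θ p).lf 1 := by
  refine Sect2.lawsRT_towerOfTerms_zero (V := FluctV N) (settingOfRecord₁₃ F N θ p) (θ.Rz p.K) θ.τ9.M s.Ω 1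
    (settingOfRecord₁₃_satisfiesRG F N θ p 1) hE₀ hB₀ fun j hj => ?_
  rcases Nat.lt_or_ge j 1 with h0 | h1
  · obtain rfl : j = 0 := Nat.lt_one_iff.mp h0
    show 0 ≤ FlowStepRuns.genSeq _ _ 0
    rw [FlowStepRuns.genSeq_zero]
    exact hg₀
  · obtain rfl : j = 1 := le_antisymm hj h1
    exact gOfRecord₁₃_succ_nonneg F N θ p 0

end LevelOne

end Summit.QuantumFields.YangMills.Theorems.BalabanUVNodesN11DiagonalLevelOneCoP

end
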